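import Mathlib
import Summits.RiemannHypothesis.RiemannHypothesis.Theorems.HandoffRealZeroCount
import HarnessLib

/-!
# Real zeros of smooth approximants, II: the count WITH MULTIPLICITY is upper semicontinuous

Handoff track (ROUTE 1′), prove-1 gen13; continuation of `HandoffRealZeroCount` (the hull form of
iterated Rolle and `eventually_ncard_zeros_le`, which bound the number of DISTINCT zeros). Here the
zeros of the approximants are weighted by multiplicity data — a finite set `S` with weights `m x`
such that `G^{(i)}(x) = 0` for `i < m x` — and the same conclusion holds for `Σ_{x ∈ S} m x`:

* `rolle_finset_strict` — Rolle for a finite zero set: `|S| − 1` zeros of `g'` strictly inside the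
  gaps, disjoint from `S`;
* `exists_iteratedDeriv_eq_zero_of_sum_mult` — Rolle with multiplicities: if `Σ m ≥ M + 1` then
  `F^{(M)}` vanishes somewhere in the hull (induction: pass to `F'` with weights `m − 1` on `S` and `1`
  on the Rolle points);
* `sum_mult_le_of_iteratedDeriv_ne_zero` — so `F^{(M)} ≠ 0` on `[u, v]` bounds `Σ m ≤ M`;
* `eventually_sum_mult_zeros_le` — for `G_n → g` with `G_n^{(k_c)} → g^{(k_c)}` uniformly on
  `[a, b]` near the zeros `c` of `g` (of order `k_c`), eventually every multiplicity datum of `G_n` on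
  `[a, b]` has `Σ m ≤ Σ_c k_c`.

Used by `HandoffCountThinMult` (ROUTE R-K with the count law WITH multiplicity, which makes the
existential criterion EXACTLY equivalent to RH). Pure real analysis; nothing here bears on RH.
-/

set_option linter.dupNamespace false  -- the mandated namespace repeats `RiemannHypothesis`

noncomputable section

open Filter Set Topology Metric
open scoped BigOperators

namespace Summit.RiemannHypothesis.RiemannHypothesis.Theorems

namespace RealZeroCount

variable {ι : Type*} {l : Filter ι}

/-- **Rolle for a finite zero set, strict form.** If the continuous `g` vanishes on a nonempty finite
set `S` with `|S| = n + 1`, there are `n` zeros of `deriv g` strictly between `min S` and `max S`,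
pairwise distinct and not in `S` (one in each gap between consecutive points). -/
theorem rolle_finset_strict {g : ℝ → ℝ} (hg : Continuous g) :
    ∀ (n : ℕ) (S : Finset ℝ) (hS : S.Nonempty), S.card = n + 1 → (∀ x ∈ S, g x = 0) →
      ∃ R : Finset ℝ, R.card = n ∧ Disjoint R S ∧ (∀ y ∈ R, deriv g y = 0) ∧
        ∀ y ∈ R, S.min' hS < y ∧ y < S.max' hS := by
  intro n
  induction n with
  | zero =>
    intro S hS _ _
    exact ⟨∅, by simp, by simp, by simp, by simp⟩
  | succ n ih =>
    intro S hS hcard hz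
    set b := S.max' hS with hb
    have hbS : b ∈ S := S.max'_mem hS
    set S₀ := S.erase b with hS₀
    have hcard₀ : S₀.card = n + 1 := by rw [Finset.card_erase_of_mem hbS, hcard]; rfl
    have hS₀ne : S₀.Nonempty := Finset.card_pos.mp (by omega)
    obtain ⟨R₀, hR₀card, hR₀disj, hR₀zero, hR₀in⟩ :=
      ih S₀ hS₀ne hcard₀ fun x hx => hz x (Finset.mem_of_mem_erase hx)
    set a := S₀.max' hS₀ne with ha
    have haS₀ : a ∈ S₀ := S₀.max'_mem hS₀ne
    have haS : a ∈ S := Finset.mem_of_mem_erase haS₀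
    have hab : a < b := lt_of_le_of_ne (S.le_max' a haS) (Finset.ne_of_mem_erase haS₀)
    obtain ⟨ρ, hρ, hρ0⟩ := exists_deriv_eq_zero hab hg.continuousOn (by rw [hz a haS, hz b hbS])
    have hρR₀ : ρ ∉ R₀ := fun h => by linarith [(hR₀in ρ h).2, hρ.1]
    refine ⟨insert ρ R₀, by rw [Finset.card_insert_of_notMem hρR₀, hR₀card], ?_, ?_, ?_⟩
    · rw [Finset.disjoint_insert_left]
      refine ⟨fun hρS => ?_, ?_⟩
      · rcases eq_or_ne ρ b with h | h
        · exact absurd h (ne_of_lt hρ.2)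
        · have := S₀.le_max' ρ (Finset.mem_erase.mpr ⟨h, hρS⟩)
          linarith [hρ.1]
      · rw [Finset.disjoint_iff_ne] at hR₀disj ⊢
        intro y hy x hx
        rcases eq_or_ne x b with h | h
        · rw [h]; exact ne_of_lt ((hR₀in y hy).2.trans hab)
        · exact hR₀disj y hy x (Finset.mem_erase.mpr ⟨h, hx⟩)
    · intro y hy
      rcases Finset.mem_insert.mp hy with rfl | hy
      · exact hρ0
      · exact hR₀zero y hy
    · intro y hy
      have hmin : S.min' hS ≤ S₀.min' hS₀ne :=
        S.min'_le _ (Finset.mem_of_mem_erase (S₀.min'_mem hS₀ne))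
      have hmina : S.min' hS ≤ a := S.min'_le a haS
      rcases Finset.mem_insert.mp hy with rfl | hy
      · exact ⟨lt_of_le_of_lt hmina hρ.1, hρ.2⟩
      · obtain ⟨h1, h2⟩ := hR₀in y hy
        exact ⟨lt_of_le_of_lt hmin h1, h2.trans hab⟩

/-- **Rolle with multiplicities.** `F ∈ C^N`, `S ⊆ [u, v]` finite with weights `m`, and
`F^{(k+i)}(x) = 0` for `x ∈ S`, `i < m x`; if `Σ_{x ∈ S} m x ≥ M + 1` (`k + M ≤ N`) then `F^{(k+M)}`
vanishes somewhere in `[u, v]`. -/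
theorem exists_iteratedDeriv_eq_zero_of_sum_mult {F : ℝ → ℝ} {N : ℕ} (hF : ContDiff ℝ N F)
    {u v : ℝ} :
    ∀ (M k : ℕ) (S : Finset ℝ) (m : ℝ → ℕ), k + M ≤ N → M + 1 ≤ ∑ x ∈ S, m x →
      (∀ x ∈ S, x ∈ Icc u v) → (∀ x ∈ S, ∀ i < m x, iteratedDeriv (k + i) F x = 0) →
        ∃ ξ ∈ Icc u v, iteratedDeriv (k + M) F ξ = 0 := by
  classical
  intro M
  induction M with
  | zero =>
    intro k S m _ hsum hS hm
    obtain ⟨x, hx, hmx⟩ : ∃ x ∈ S, 1 ≤ m x := by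
      by_contra h
      push Not at h
      have : ∑ x ∈ S, m x = 0 := Finset.sum_eq_zero fun x hx => by have := h x hx; omega
      omega
    exact ⟨x, hS x hx, by simpa using hm x hx 0 (by omega)⟩
  | succ M ih =>
    intro k S m hkN hsum hS hm
    -- the points of positive weight
    set S' := S.filter (fun x => 1 ≤ m x) with hS'
    have hsum' : ∑ x ∈ S', m x = ∑ x ∈ S, m x := by
      rw [hS', Finset.sum_filter]
      exact Finset.sum_congr rfl fun x _ => by
        by_cases h : 1 ≤ m x
        · simp [h]
        · simp [h]; omega
    have hS'ne : S'.Nonempty := by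
      rw [Finset.nonempty_iff_ne_empty]
      intro h
      rw [h, Finset.sum_empty] at hsum'
      omega
    -- `g := F^{(k)}` vanishes on `S'`
    set g := iteratedDeriv k F with hg
    have hgc : Continuous g :=
      hF.continuous_iteratedDeriv k (by exact_mod_cast (by omega : k ≤ N))
    have hgz : ∀ x ∈ S', g x = 0 := fun x hx => by
      simpa [g] using hm x (Finset.mem_filter.mp hx).1 0 (by have := (Finset.mem_filter.mp hx).2; omega)
    obtain ⟨R, hRcard, hRdisj, hRzero, hRin⟩ :=
      rolle_finset_strict hgc (S'.card - 1) S' hS'ne (by have := hS'ne.card_pos; omega) hgz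
    have hdisjR : ∀ y ∈ R, y ∉ S' := fun y hy h => Finset.disjoint_left.mp hRdisj hy h
    -- new weights at level `k + 1`
    set m' : ℝ → ℕ := fun x => if x ∈ R then 1 else m x - 1 with hm'
    have hsumU : ∑ x ∈ S' ∪ R, m' x = ∑ x ∈ S', (m x - 1) + R.card := by
      rw [Finset.sum_union (Finset.disjoint_left.mpr fun x hx hR => hdisjR x hR hx)]
      congr 1
      · exact Finset.sum_congr rfl fun x hx => by
          have : x ∉ R := fun h => hdisjR x h hx
          simp [m', this]
      · rw [Finset.card_eq_sum_ones]
        exact Finset.sum_congr rfl fun x hx => by simp [m', hx]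
    have hsum1 : ∑ x ∈ S', (m x - 1) + S'.card = ∑ x ∈ S', m x := by
      rw [Finset.card_eq_sum_ones, ← Finset.sum_add_distrib]
      exact Finset.sum_congr rfl fun x hx => by have := (Finset.mem_filter.mp hx).2; omega
    have hsum'' : M + 1 ≤ ∑ x ∈ S' ∪ R, m' x := by
      rw [hsumU]
      have := hS'ne.card_pos
      omega
    have hloc : ∀ x ∈ S' ∪ R, x ∈ Icc u v := by
      intro x hx
      rcases Finset.mem_union.mp hx with hx | hx
      · exact hS x (Finset.mem_filter.mp hx).1
      · obtain ⟨h1, h2⟩ := hRin x hx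
        have hminI := hS _ (Finset.mem_filter.mp (S'.min'_mem hS'ne)).1
        have hmaxI := hS _ (Finset.mem_filter.mp (S'.max'_mem hS'ne)).1
        exact ⟨hminI.1.trans h1.le, h2.le.trans hmaxI.2⟩
    have hder : ∀ x ∈ S' ∪ R, ∀ i < m' x, iteratedDeriv (k + 1 + i) F x = 0 := by
      intro x hx i hi
      by_cases hxR : x ∈ R
      · have hi0 : i = 0 := by simp [m', hxR] at hi; omega
        subst hi0
        rw [add_zero, iteratedDeriv_succ]
        exact hRzero x hxR
      · have hxS' : x ∈ S' := by
          rcases Finset.mem_union.mp hx with h | h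
          · exact h
          · exact absurd h hxR
        have hi' : i + 1 < m x := by simp [m', hxR] at hi; omega
        have := hm x (Finset.mem_filter.mp hxS').1 (i + 1) hi'
        rw [show k + 1 + i = k + (i + 1) by ring]
        exact this
    obtain ⟨ξ, hξ, h⟩ := ih (k + 1) (S' ∪ R) m' (by omega) hsum'' hloc hder
    exact ⟨ξ, hξ, by rw [show k + (M + 1) = k + 1 + M by ring]; exact h⟩

/-- If `F^{(M)} ≠ 0` on `[u, v]` (`F ∈ C^N`, `M ≤ N`), every multiplicity datum of zeros of `F` in
`[u, v]` has total weight `Σ m ≤ M`. -/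
theorem sum_mult_le_of_iteratedDeriv_ne_zero {F : ℝ → ℝ} {N M : ℕ} (hF : ContDiff ℝ N F)
    (hM : M ≤ N) {u v : ℝ} (hne : ∀ x ∈ Icc u v, iteratedDeriv M F x ≠ 0) (S : Finset ℝ)
    (m : ℝ → ℕ) (hS : ∀ x ∈ S, x ∈ Icc u v)
    (hm : ∀ x ∈ S, ∀ i < m x, iteratedDeriv i F x = 0) : ∑ x ∈ S, m x ≤ M := by
  by_contra h
  push Not at h
  obtain ⟨ξ, hξ, h0⟩ := exists_iteratedDeriv_eq_zero_of_sum_mult hF M 0 S m (by omega) (by omega)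
    hS (fun x hx i hi => by simpa using hm x hx i hi)
  exact hne ξ hξ (by simpa using h0)

/-- **Upper semicontinuity of the real zero count WITH multiplicity.** Same setting as
`eventually_ncard_zeros_le`: `g` continuous on `[a, b]` with zeros in the finite set `Z`, of orders
`k c ≤ N` (`g^{(k c)}(c) ≠ 0`, `g^{(k c)}` continuous at `c`); `G_n ∈ C^N` eventually, `G_n → g`
and `G_n^{(k c)} → g^{(k c)}` uniformly on `[a, b]`. Then eventually: for every finite `S ⊆ [a, b]`
and weights `m ≥ 1` on `S` with `G_n^{(i)}(x) = 0` for `x ∈ S`, `i < m x`, the total weight is at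
most `Σ_{c ∈ Z} k c`. -/
theorem eventually_sum_mult_zeros_le {g : ℝ → ℝ} {G : ι → ℝ → ℝ} {a b : ℝ} {Z : Finset ℝ}
    {k : ℝ → ℕ} {N : ℕ} (hg : Continuous g)
    (hZ : ∀ x ∈ Icc a b, g x = 0 → x ∈ Z)
    (hkcont : ∀ c ∈ Z, ContinuousAt (iteratedDeriv (k c) g) c)
    (hkne : ∀ c ∈ Z, iteratedDeriv (k c) g c ≠ 0)
    (hkN : ∀ c ∈ Z, k c ≤ N)
    (hGN : ∀ᶠ n in l, ContDiff ℝ N (G n))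
    (hG : TendstoUniformlyOn G g l (Icc a b))
    (hGk : ∀ c ∈ Z, TendstoUniformlyOn (fun n => iteratedDeriv (k c) (G n))
      (iteratedDeriv (k c) g) l (Icc a b)) :
    ∀ᶠ n in l, ∀ (S : Finset ℝ) (m : ℝ → ℕ), (∀ x ∈ S, x ∈ Icc a b) → (∀ x ∈ S, 1 ≤ m x) →
      (∀ x ∈ S, ∀ i < m x, iteratedDeriv i (G n) x = 0) → ∑ x ∈ S, m x ≤ ∑ c ∈ Z, k c := by
  classical
  -- Step 1: radii around the points of `Z` on which `|g^{(k c)}| ≥ η c > 0`.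
  have hrad : ∀ c ∈ Z, ∃ r η : ℝ, 0 < r ∧ 0 < η ∧
      ∀ x, dist x c ≤ r → η ≤ |iteratedDeriv (k c) g x| := by
    intro c hc
    set w := iteratedDeriv (k c) g c with hw
    have hw0 : 0 < |w| := abs_pos.mpr (hkne c hc)
    obtain ⟨r, hr, hball⟩ := Metric.continuousAt_iff.mp (hkcont c hc) (|w| / 2) (by positivity)
    refine ⟨r / 2, |w| / 2, by positivity, by positivity, fun x hx => ?_⟩
    have hlt : dist (iteratedDeriv (k c) g x) w < |w| / 2 := hball (lt_of_le_of_lt hx (by linarith))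
    rw [Real.dist_eq] at hlt
    have := abs_sub_abs_le_abs_sub w (iteratedDeriv (k c) g x)
    rw [abs_sub_comm] at this
    linarith
  choose! r η hr hη hbound using hrad
  -- Step 2: away from these neighbourhoods `|g| ≥ η₀ > 0` on `[a, b]`.
  set K : Set ℝ := Icc a b ∩ {x | ∀ c ∈ Z, r c ≤ dist x c} with hK
  have hKc : IsCompact K := by
    refine isCompact_Icc.inter_right ?_
    have : {x : ℝ | ∀ c ∈ Z, r c ≤ dist x c} = ⋂ c ∈ Z, {x | r c ≤ dist x c} := by
      ext x; simp
    rw [this]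
    exact isClosed_biInter fun c _ => isClosed_le continuous_const (continuous_id.dist continuous_const)
  have hKne : ∀ x ∈ K, g x ≠ 0 := by
    rintro x ⟨hxI, hxfar⟩ hx0
    have hxZ := hZ x hxI hx0
    have := hxfar x hxZ
    rw [dist_self] at this
    exact absurd this (not_le.mpr (hr x hxZ))
  obtain ⟨η₀, hη₀, hη₀K⟩ : ∃ η₀ : ℝ, 0 < η₀ ∧ ∀ x ∈ K, η₀ ≤ |g x| := by
    rcases K.eq_empty_or_nonempty with hKe | hKn
    · exact ⟨1, one_pos, by simp [hKe]⟩
    · obtain ⟨x₀, hx₀, hmin⟩ := hKc.exists_isMinOn hKn (hg.abs).continuousOn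
      exact ⟨|g x₀|, abs_pos.mpr (hKne x₀ hx₀), fun x hx => hmin hx⟩
  -- Step 3: eventually `G n` is `η₀`-close to `g` and `(G n)^{(k c)}` is `η c`-close to `g^{(k c)}`.
  have h1 : ∀ᶠ n in l, ∀ x ∈ Icc a b, |G n x - g x| < η₀ := by
    have := (Metric.tendstoUniformlyOn_iff.mp hG) η₀ hη₀
    filter_upwards [this] with n hn x hx
    rw [← Real.dist_eq, dist_comm]; exact hn x hx
  have h2 : ∀ᶠ n in l, ∀ c ∈ Z, ∀ x ∈ Icc a b,
      |iteratedDeriv (k c) (G n) x - iteratedDeriv (k c) g x| < η c := by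
    refine (Z.eventually_all).mpr fun c hc => ?_
    have := (Metric.tendstoUniformlyOn_iff.mp (hGk c hc)) (η c) (hη c hc)
    filter_upwards [this] with n hn x hx
    rw [← Real.dist_eq, dist_comm]; exact hn x hx
  filter_upwards [h1, h2, hGN] with n hn1 hn2 hnN
  -- Step 4: a multiplicity datum splits along the neighbourhoods; each piece weighs at most `k c`.
  intro S m hS h1m hm
  have hz : ∀ x ∈ S, G n x = 0 := fun x hx => by simpa using hm x hx 0 (h1m x hx)
  have hnear : ∀ x ∈ S, ∃ c ∈ Z, dist x c < r c := by
    intro x hx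
    by_contra hcon
    push Not at hcon
    have hxK : x ∈ K := ⟨hS x hx, hcon⟩
    have := hn1 x (hS x hx)
    rw [hz x hx, zero_sub, abs_neg] at this
    exact absurd (hη₀K x hxK) (not_le.mpr this)
  choose! cc hccZ hccd using hnear
  rw [← Finset.sum_fiberwise_of_maps_to (g := cc) (fun x hx => hccZ x hx)]
  refine Finset.sum_le_sum fun c hc => ?_
  refine sum_mult_le_of_iteratedDeriv_ne_zero hnN (hkN c hc)
    (u := max a (c - r c)) (v := min b (c + r c)) ?_ _ m ?_ ?_
  · intro x hx hx0
    have hxI : x ∈ Icc a b := ⟨(le_max_left _ _).trans hx.1, hx.2.trans (min_le_left _ _)⟩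
    have hxc : dist x c ≤ r c := by
      rw [Real.dist_eq, abs_le]
      constructor <;> linarith [(le_max_right _ _).trans hx.1, hx.2.trans (min_le_right _ _)]
    have hb := hbound c hc x hxc
    have := hn2 c hc x hxI
    rw [hx0, zero_sub, abs_neg] at this
    exact absurd hb (not_le.mpr this)
  · intro x hx
    obtain ⟨hxS, hxc⟩ := Finset.mem_filter.mp hx
    have hxI := hS x hxS
    have hd := hccd x hxS
    rw [hxc, Real.dist_eq, abs_lt] at hd
    exact ⟨max_le hxI.1 (by linarith), le_min hxI.2 (by linarith)⟩
  · intro x hx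
    exact hm x (Finset.mem_filter.mp hx).1

/-! Axiom census (expected `propext`, `Classical.choice`, `Quot.sound`). -/
#print axioms eventually_sum_mult_zeros_le

end RealZeroCount

end Summit.RiemannHypothesis.RiemannHypothesis.Theorems

end
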